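import Mathlib.Analysis.SpecialFunctions.SmoothTransition
import Mathlib.Analysis.Calculus.ContDiff.Bounds
import Mathlib.Analysis.Calculus.IteratedDeriv.Lemmas
import Mathlib.Analysis.SpecialFunctions.Log.Deriv
import Mathlib.Analysis.SpecialFunctions.ExpDeriv
import Mathlib.Analysis.SpecialFunctions.Pow.Real
import Mathlib.MeasureTheory.Integral.Bochner.Set
import Mathlib.MeasureTheory.Measure.Lebesgue.Basic
import Mathlib.Analysis.Complex.RealDeriv
import Mathlib.Analysis.Complex.ExponentialBounds
import HarnessLib

/-!
# Smooth weights for cubes in logarithmic coordinates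

Topic `Literature/NumberTheory/Sieve`, sub-namespace `SmoothWeights`. Pure real analysis used by the
smooth form of the Bombieri–Vinogradov theorem over a totally real field (Hinz 1988; the sieve
files `SmoothIdealCosetSums.lean` and its sequels): a one-parameter family of smooth approximations
of the indicator of `(0, 1]`, built in the logarithmic variable `v = log r` from Mathlib's
`Real.smoothTransition`:

* `kappa a ε v = ST((v - a)/log 2 + 1) · ST(-v/ε)` — equal to `1` on `[a, -ε]`, supported in
  `[a - log 2, 0]`, with values in `[0, 1]` (`kappa_eq_one`, `kappa_eq_zero_of_le`,
  `kappa_eq_zero_of_ge`, `kappa_nonneg`, `kappa_le_one`) and `|κ^{(n)}| ≤ K_n ε^{-n}` for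
  `0 < ε ≤ 1` with `K_n` ABSOLUTE (`norm_iteratedDeriv_kappa_le`): the lower transition has width
  `log 2`, only the upper one is sharp;
* `kappaT a ε t v = κ(v) e^{-tv}` — the twist absorbing the factor `N(α)^{-t}` of the integral
  `1/log N(α) = ∫₀^∞ N(α)^{-t} dt`; `|κ_t^{(n)}(v)| ≤ K'_n ε^{-n} (1+t)^n e^{t(log 2 - a)}`
  (`norm_iteratedDeriv_kappaT_le`);
* `gfun a ε t r = κ_t(log r)` (`r > 0`; `0` for `r ≤ 0`) — the weight in the linear variable:
  smooth, supported in `[e^a/2, 1]`, with the explicit third derivative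
  `(κ_t''' - 3κ_t'' + 2κ_t')(log r)/r³` (`iteratedDeriv_three_gfun`) and the bounds
  `∫|g| ≤ e^{t(log 2 - a)}`, `∫|g'''| ≤ 48 K'₃ ε^{-3}(1+t)³ e^{t(log 2 - a)} e^{-3a}`
  (`integral_norm_gfunC_le`, `integral_norm_iteratedDeriv_gfunC_le`, complex-valued versions for
  the Fourier estimates of `SmoothIdealCosetSums.norm_fourier_le_dec`).

All statements are theorems; the only definitions are the three weights and the absolute
constants `stC n` (a bound for `|ST^{(n)}|`), `kappaC n`, `kappaTC n`.

## References

* J. Hinz, *A generalization of Bombieri's prime number theorem to algebraic number fields*,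
  Acta Arith. 51 (1988) — the boxes `ℜ(y)` of §1 are replaced by these smooth cube weights.
  [cite: Hinz1988, §1]
-/

noncomputable section

open Real Set Filter MeasureTheory
open scoped Topology ContDiff

namespace Literature.NumberTheory.Sieve.SmoothWeights

/-! ## Derivatives of `Real.smoothTransition` are bounded -/

/-- Iterated derivatives of compactly supported functions are compactly supported. [folklore] -/
theorem hasCompactSupport_iteratedDeriv_of {f : ℝ → ℝ} (hf : HasCompactSupport f) (n : ℕ) :
    HasCompactSupport (iteratedDeriv n f) := by
  induction n with
  | zero => simpa using hf
  | succ n ih => rw [iteratedDeriv_succ]; exact ih.deriv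

/-- `ST' = 0` to the left of `0`. [folklore] -/
theorem deriv_smoothTransition_of_neg {x : ℝ} (hx : x < 0) : deriv smoothTransition x = 0 := by
  have h : smoothTransition =ᶠ[𝓝 x] fun _ => (0 : ℝ) :=
    (eventually_lt_nhds hx).mono fun y hy => smoothTransition.zero_of_nonpos hy.le
  rw [h.deriv_eq, deriv_const]

/-- `ST' = 0` to the right of `1`. [folklore] -/
theorem deriv_smoothTransition_of_one_lt {x : ℝ} (hx : 1 < x) : deriv smoothTransition x = 0 := by
  have h : smoothTransition =ᶠ[𝓝 x] fun _ => (1 : ℝ) :=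
    (eventually_gt_nhds hx).mono fun y hy => smoothTransition.one_of_one_le hy.le
  rw [h.deriv_eq, deriv_const]

/-- `ST'` has compact support (in `[0, 1]`). [folklore] -/
theorem hasCompactSupport_deriv_smoothTransition : HasCompactSupport (deriv smoothTransition) := by
  refine HasCompactSupport.intro isCompact_Icc (K := Icc (0 : ℝ) 1) fun x hx => ?_
  rw [mem_Icc, not_and_or, not_le, not_le] at hx
  rcases hx with h | h
  · exact deriv_smoothTransition_of_neg h
  · exact deriv_smoothTransition_of_one_lt h

/-- **Every derivative of `ST` is bounded.** [folklore] -/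
theorem exists_bound_iteratedDeriv_smoothTransition (n : ℕ) :
    ∃ C : ℝ, 0 ≤ C ∧ ∀ x, ‖iteratedDeriv n smoothTransition x‖ ≤ C := by
  rcases n with _ | k
  · refine ⟨1, zero_le_one, fun x => ?_⟩
    rw [iteratedDeriv_zero, Real.norm_eq_abs, abs_of_nonneg (smoothTransition.nonneg x)]
    exact smoothTransition.le_one x
  · have hcont : Continuous (iteratedDeriv (k + 1) smoothTransition) :=
      smoothTransition.contDiff.continuous_iteratedDeriv (k + 1) (by exact_mod_cast le_top)
    have hsupp : HasCompactSupport (iteratedDeriv (k + 1) smoothTransition) := by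
      rw [iteratedDeriv_succ']
      exact hasCompactSupport_iteratedDeriv_of hasCompactSupport_deriv_smoothTransition k
    obtain ⟨C, hC⟩ := hcont.bounded_above_of_compact_support hsupp
    exact ⟨max C 0, le_max_right _ _, fun x => (hC x).trans (le_max_left _ _)⟩

/-- An absolute bound `stC n ≥ |ST^{(n)}|` (exists by compactness). [folklore] -/
def stC (n : ℕ) : ℝ := (exists_bound_iteratedDeriv_smoothTransition n).choose

/-- `stC n ≥ 0`. [folklore] -/
theorem stC_nonneg (n : ℕ) : 0 ≤ stC n := (exists_bound_iteratedDeriv_smoothTransition n).choose_spec.1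

/-- `|ST^{(n)}| ≤ stC n`. [folklore] -/
theorem norm_iteratedDeriv_smoothTransition_le (n : ℕ) (x : ℝ) :
    ‖iteratedDeriv n smoothTransition x‖ ≤ stC n :=
  (exists_bound_iteratedDeriv_smoothTransition n).choose_spec.2 x

/-- Derivatives of an affine reparametrisation `x ↦ ST(c x + s)`. [folklore] -/
theorem iteratedDeriv_smoothTransition_affine (n : ℕ) (c s x : ℝ) :
    iteratedDeriv n (fun y => smoothTransition (c * y + s)) x =
      c ^ n * iteratedDeriv n smoothTransition (c * x + s) := by
  have h1 : iteratedDeriv n (fun y => smoothTransition (y + s)) =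
      fun y => iteratedDeriv n smoothTransition (y + s) := iteratedDeriv_comp_add_const n _ s
  have h2 := iteratedDeriv_comp_const_mul (n := n) (f := fun y => smoothTransition (y + s))
    (smoothTransition.contDiff.comp (contDiff_id.add contDiff_const)) c
  have h3 := congrFun h2 x
  rw [h3, h1]

/-- `|(ST(c·+s))^{(n)}| ≤ |c|^n stC n`. [folklore] -/
theorem norm_iteratedDeriv_smoothTransition_affine_le (n : ℕ) (c s x : ℝ) :
    ‖iteratedDeriv n (fun y => smoothTransition (c * y + s)) x‖ ≤ |c| ^ n * stC n := by
  rw [iteratedDeriv_smoothTransition_affine, norm_mul, norm_pow, Real.norm_eq_abs]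
  exact mul_le_mul_of_nonneg_left (norm_iteratedDeriv_smoothTransition_le n _) (by positivity)

/-! ## The logarithmic profile `κ` -/

/-- **The profile** `κ_{a,ε}(v) = ST((v - a)/log 2 + 1) · ST(-v/ε)`: a smooth approximation of the
indicator of `[a, 0]` in the variable `v = log r`, with a wide (`log 2`) lower transition and a
sharp (`ε`) upper one. [folklore] -/
def kappa (a ε v : ℝ) : ℝ :=
  smoothTransition ((v - a) / Real.log 2 + 1) * smoothTransition (-v / ε)

/-- `κ ≥ 0`. [folklore] -/
theorem kappa_nonneg (a ε v : ℝ) : 0 ≤ kappa a ε v :=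
  mul_nonneg (smoothTransition.nonneg _) (smoothTransition.nonneg _)

/-- `κ ≤ 1`. [folklore] -/
theorem kappa_le_one (a ε v : ℝ) : kappa a ε v ≤ 1 :=
  mul_le_one₀ (smoothTransition.le_one _) (smoothTransition.nonneg _) (smoothTransition.le_one _)

/-- `|κ| ≤ 1`. [folklore] -/
theorem abs_kappa_le_one (a ε v : ℝ) : |kappa a ε v| ≤ 1 := by
  rw [abs_of_nonneg (kappa_nonneg _ _ _)]; exact kappa_le_one _ _ _

/-- `κ = 1` on `[a, -ε]`. [folklore] -/
theorem kappa_eq_one {a ε v : ℝ} (hε : 0 < ε) (hav : a ≤ v) (hvε : v ≤ -ε) : kappa a ε v = 1 := by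
  unfold kappa
  rw [smoothTransition.one_of_one_le, smoothTransition.one_of_one_le, one_mul]
  · rw [le_div_iff₀ hε]; linarith
  · have h2 : 0 < Real.log 2 := Real.log_pos one_lt_two
    have : 0 ≤ (v - a) / Real.log 2 := div_nonneg (by linarith) h2.le
    linarith

/-- `κ = 0` on `(-∞, a - log 2]`. [folklore] -/
theorem kappa_eq_zero_of_le {a ε v : ℝ} (hv : v ≤ a - Real.log 2) : kappa a ε v = 0 := by
  unfold kappa
  rw [smoothTransition.zero_of_nonpos, zero_mul]
  have h2 : 0 < Real.log 2 := Real.log_pos one_lt_two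
  rw [div_add_one h2.ne', div_nonpos_iff]
  exact Or.inr ⟨by linarith, h2.le⟩

/-- `κ = 0` on `[0, ∞)`. [folklore] -/
theorem kappa_eq_zero_of_ge {a ε v : ℝ} (hε : 0 < ε) (hv : 0 ≤ v) : kappa a ε v = 0 := by
  unfold kappa
  rw [smoothTransition.zero_of_nonpos (x := -v / ε), mul_zero]
  exact div_nonpos_iff.2 (Or.inr ⟨by linarith, hε.le⟩)

/-- `κ` is smooth. [folklore] -/
theorem contDiff_kappa (a ε : ℝ) {n : ℕ∞} : ContDiff ℝ n (kappa a ε) := by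
  unfold kappa
  exact (smoothTransition.contDiff.comp ((contDiff_id.sub contDiff_const).div_const _ |>.add
    contDiff_const)).mul (smoothTransition.contDiff.comp (contDiff_id.neg.div_const _))

/-- `supp κ ⊆ [a - log 2, 0]`. [folklore] -/
theorem support_kappa_subset {a ε : ℝ} (hε : 0 < ε) :
    Function.support (kappa a ε) ⊆ Icc (a - Real.log 2) 0 := by
  intro v hv
  rw [Function.mem_support] at hv
  rw [mem_Icc]
  constructor
  · by_contra h; push Not at h; exact hv (kappa_eq_zero_of_le h.le)
  · by_contra h; push Not at h; exact hv (kappa_eq_zero_of_ge hε h.le)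

/-- `tsupp κ ⊆ [a - log 2, 0]`. [folklore] -/
theorem tsupport_kappa_subset {a ε : ℝ} (hε : 0 < ε) : tsupport (kappa a ε) ⊆ Icc (a - Real.log 2) 0 :=
  closure_minimal (support_kappa_subset hε) isClosed_Icc

/-- `κ` has compact support. [folklore] -/
theorem hasCompactSupport_kappa {a ε : ℝ} (hε : 0 < ε) : HasCompactSupport (kappa a ε) :=
  HasCompactSupport.of_support_subset_isCompact isCompact_Icc (support_kappa_subset hε)

/-- The absolute constants `K_n = ∑_i C(n,i) 2^i C_i C_{n-i}` bounding `ε^n |κ^{(n)}|`. [folklore] -/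
def kappaC (n : ℕ) : ℝ :=
  ∑ i ∈ Finset.range (n + 1), (n.choose i : ℝ) * (2 ^ i * stC i) * stC (n - i)

/-- `kappaC n ≥ 0`. [folklore] -/
theorem kappaC_nonneg (n : ℕ) : 0 ≤ kappaC n :=
  Finset.sum_nonneg fun i _ => by have := stC_nonneg i; have := stC_nonneg (n - i); positivity

/-- **Derivative bounds for `κ`**: `|κ^{(n)}(v)| ≤ K_n ε^{-n}` for `0 < ε ≤ 1` (Leibniz; the two
factors are affine reparametrisations of `ST` with slopes `1/log 2 ≤ 2` and `-1/ε`). [folklore] -/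
theorem norm_iteratedDeriv_kappa_le (n : ℕ) (a : ℝ) {ε : ℝ} (hε : 0 < ε) (hε1 : ε ≤ 1) (v : ℝ) :
    ‖iteratedDeriv n (kappa a ε) v‖ ≤ kappaC n * (ε ^ n)⁻¹ := by
  have h2 : 0 < Real.log 2 := Real.log_pos one_lt_two
  have hlog2 : (Real.log 2)⁻¹ ≤ 2 := by
    rw [inv_le_comm₀ h2 two_pos]
    have := Real.log_two_gt_d9; linarith
  -- the two factors as affine reparametrisations
  set B : ℝ → ℝ := fun y => smoothTransition ((Real.log 2)⁻¹ * y + (1 - a / Real.log 2)) with hB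
  set T : ℝ → ℝ := fun y => smoothTransition (-ε⁻¹ * y + 0) with hT
  have hκ : kappa a ε = fun y => B y * T y := by
    funext y
    simp only [kappa, hB, hT]
    congr 2
    · field_simp; ring
    · rw [add_zero, neg_mul, ← div_eq_inv_mul]; ring_nf
  have hBc : ContDiff ℝ (n : ℕ∞) B :=
    smoothTransition.contDiff.comp ((contDiff_const.mul contDiff_id).add contDiff_const)
  have hTc : ContDiff ℝ (n : ℕ∞) T :=
    smoothTransition.contDiff.comp ((contDiff_const.mul contDiff_id).add contDiff_const)
  have hBi : ∀ i, ‖iteratedFDeriv ℝ i B v‖ ≤ 2 ^ i * stC i := by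
    intro i
    rw [norm_iteratedFDeriv_eq_norm_iteratedDeriv]
    calc ‖iteratedDeriv i B v‖ ≤ |(Real.log 2)⁻¹| ^ i * stC i :=
          norm_iteratedDeriv_smoothTransition_affine_le i _ _ v
      _ ≤ 2 ^ i * stC i := by
          refine mul_le_mul_of_nonneg_right ?_ (stC_nonneg i)
          rw [abs_of_pos (inv_pos.2 h2)]
          exact pow_le_pow_left₀ (inv_pos.2 h2).le hlog2 i
  have hTi : ∀ i, ‖iteratedFDeriv ℝ i T v‖ ≤ (ε ^ i)⁻¹ * stC i := by
    intro i
    rw [norm_iteratedFDeriv_eq_norm_iteratedDeriv]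
    calc ‖iteratedDeriv i T v‖ ≤ |(-ε⁻¹)| ^ i * stC i :=
          norm_iteratedDeriv_smoothTransition_affine_le i _ _ v
      _ = (ε ^ i)⁻¹ * stC i := by rw [abs_neg, abs_of_pos (inv_pos.2 hε), inv_pow]
  rw [← norm_iteratedFDeriv_eq_norm_iteratedDeriv, hκ]
  calc ‖iteratedFDeriv ℝ n (fun y => B y * T y) v‖
      ≤ ∑ i ∈ Finset.range (n + 1), (n.choose i : ℝ) * ‖iteratedFDeriv ℝ i B v‖ *
          ‖iteratedFDeriv ℝ (n - i) T v‖ :=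
        norm_iteratedFDeriv_mul_le hBc hTc v (by exact_mod_cast le_rfl)
    _ ≤ ∑ i ∈ Finset.range (n + 1), (n.choose i : ℝ) * (2 ^ i * stC i) * ((ε ^ (n - i))⁻¹ * stC (n - i)) := by
        refine Finset.sum_le_sum fun i _ => ?_
        have h1 := hBi i
        have h2 := hTi (n - i)
        have : 0 ≤ (n.choose i : ℝ) := by positivity
        calc (n.choose i : ℝ) * ‖iteratedFDeriv ℝ i B v‖ * ‖iteratedFDeriv ℝ (n - i) T v‖
            ≤ (n.choose i : ℝ) * (2 ^ i * stC i) * ‖iteratedFDeriv ℝ (n - i) T v‖ := by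
              gcongr
          _ ≤ (n.choose i : ℝ) * (2 ^ i * stC i) * ((ε ^ (n - i))⁻¹ * stC (n - i)) := by
              have : 0 ≤ (n.choose i : ℝ) * (2 ^ i * stC i) := by
                have := stC_nonneg i; positivity
              exact mul_le_mul_of_nonneg_left h2 this
    _ ≤ ∑ i ∈ Finset.range (n + 1), (n.choose i : ℝ) * (2 ^ i * stC i) * ((ε ^ n)⁻¹ * stC (n - i)) := by
        refine Finset.sum_le_sum fun i _ => ?_
        have hi0 : 0 ≤ (n.choose i : ℝ) * (2 ^ i * stC i) := by have := stC_nonneg i; positivity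
        refine mul_le_mul_of_nonneg_left ?_ hi0
        refine mul_le_mul_of_nonneg_right ?_ (stC_nonneg _)
        exact inv_anti₀ (pow_pos hε _) (pow_le_pow_of_le_one hε.le hε1 (Nat.sub_le n i))
    _ = kappaC n * (ε ^ n)⁻¹ := by
        rw [kappaC, Finset.sum_mul]
        refine Finset.sum_congr rfl fun i _ => ?_
        ring

/-! ## The twisted profile `κ_t(v) = κ(v) e^{-tv}` -/

/-- `κ_t(v) = κ_{a,ε}(v) e^{-tv}`: in the variable `r = e^v` this is `κ(log r) r^{-t}`, the weight
carrying the factor `N(α)^{-t}`. [folklore] -/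
def kappaT (a ε t v : ℝ) : ℝ := kappa a ε v * Real.exp (-t * v)

/-- `κ_t` is smooth. [folklore] -/
theorem contDiff_kappaT (a ε t : ℝ) {n : ℕ∞} : ContDiff ℝ n (kappaT a ε t) :=
  (contDiff_kappa a ε).mul (contDiff_exp.comp (contDiff_const.mul contDiff_id))

/-- `κ_t = 0` on `(-∞, a - log 2]`. [folklore] -/
theorem kappaT_eq_zero_of_le {a ε t v : ℝ} (hv : v ≤ a - Real.log 2) : kappaT a ε t v = 0 := by
  rw [kappaT, kappa_eq_zero_of_le hv, zero_mul]

/-- `κ_t = 0` on `[0, ∞)`. [folklore] -/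
theorem kappaT_eq_zero_of_ge {a ε t v : ℝ} (hε : 0 < ε) (hv : 0 ≤ v) : kappaT a ε t v = 0 := by
  rw [kappaT, kappa_eq_zero_of_ge hε hv, zero_mul]

/-- `supp κ_t ⊆ [a - log 2, 0]`. [folklore] -/
theorem support_kappaT_subset {a ε : ℝ} (hε : 0 < ε) (t : ℝ) :
    Function.support (kappaT a ε t) ⊆ Icc (a - Real.log 2) 0 := by
  intro v hv
  rw [Function.mem_support, kappaT] at hv
  exact support_kappa_subset hε (left_ne_zero_of_mul hv)

/-- `tsupp κ_t ⊆ [a - log 2, 0]`. [folklore] -/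
theorem tsupport_kappaT_subset {a ε : ℝ} (hε : 0 < ε) (t : ℝ) :
    tsupport (kappaT a ε t) ⊆ Icc (a - Real.log 2) 0 :=
  closure_minimal (support_kappaT_subset hε t) isClosed_Icc

/-- `κ_t` has compact support. [folklore] -/
theorem hasCompactSupport_kappaT {a ε : ℝ} (hε : 0 < ε) (t : ℝ) : HasCompactSupport (kappaT a ε t) :=
  HasCompactSupport.of_support_subset_isCompact isCompact_Icc (support_kappaT_subset hε t)

/-- `e^{-tv} ≤ e^{t(log 2 - a)}` on the support. [folklore] -/
theorem exp_neg_mul_le {a t v : ℝ} (ht : 0 ≤ t) (hv : a - Real.log 2 ≤ v) :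
    Real.exp (-t * v) ≤ Real.exp (t * (Real.log 2 - a)) :=
  Real.exp_le_exp.2 (by nlinarith)

/-- `|κ_t(v)| ≤ e^{t(log 2 - a)}` (`t ≥ 0`). [folklore] -/
theorem abs_kappaT_le {a ε t : ℝ} (ht : 0 ≤ t) (v : ℝ) :
    |kappaT a ε t v| ≤ Real.exp (t * (Real.log 2 - a)) := by
  by_cases hv : a - Real.log 2 ≤ v
  · rw [kappaT, abs_mul, abs_of_pos (Real.exp_pos _)]
    calc |kappa a ε v| * Real.exp (-t * v) ≤ 1 * Real.exp (t * (Real.log 2 - a)) :=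
          mul_le_mul (abs_kappa_le_one _ _ _) (exp_neg_mul_le ht hv) (Real.exp_pos _).le zero_le_one
      _ = _ := one_mul _
  · push Not at hv
    rw [kappaT_eq_zero_of_le hv.le, abs_zero]; positivity

/-- The absolute constants `K'_n = ∑_i C(n,i) K_i`. [folklore] -/
def kappaTC (n : ℕ) : ℝ := ∑ i ∈ Finset.range (n + 1), (n.choose i : ℝ) * kappaC i

/-- `kappaTC n ≥ 0`. [folklore] -/
theorem kappaTC_nonneg (n : ℕ) : 0 ≤ kappaTC n :=
  Finset.sum_nonneg fun i _ => by have := kappaC_nonneg i; positivity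

/-- Iterated derivatives vanish off the topological support. [folklore] -/
theorem iteratedDeriv_eq_zero_of_notMem_tsupport {f : ℝ → ℝ} {n : ℕ} {v : ℝ} (hv : v ∉ tsupport f) :
    iteratedDeriv n f v = 0 := by
  have h : v ∉ Function.support (iteratedFDeriv ℝ n f) := fun h => hv (support_iteratedFDeriv_subset n h)
  rw [Function.mem_support, not_not] at h
  rw [iteratedDeriv_eq_iteratedFDeriv, h, zero_apply]

/-- **Derivative bounds for `κ_t`**: `|κ_t^{(n)}(v)| ≤ K'_n ε^{-n} (1+t)^n e^{t(log 2 - a)}` for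
`0 < ε ≤ 1`, `t ≥ 0` (Leibniz with `(e^{-tv})^{(j)} = (-t)^j e^{-tv}`; off the support of `κ`
everything vanishes). [folklore] -/
theorem norm_iteratedDeriv_kappaT_le (n : ℕ) (a : ℝ) {ε : ℝ} (hε : 0 < ε) (hε1 : ε ≤ 1) {t : ℝ}
    (ht : 0 ≤ t) (v : ℝ) :
    ‖iteratedDeriv n (kappaT a ε t) v‖ ≤
      kappaTC n * (ε ^ n)⁻¹ * (1 + t) ^ n * Real.exp (t * (Real.log 2 - a)) := by
  set E := Real.exp (t * (Real.log 2 - a)) with hE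
  have hRHS : 0 ≤ kappaTC n * (ε ^ n)⁻¹ * (1 + t) ^ n * E := by
    have := kappaTC_nonneg n; positivity
  by_cases hv : v ∈ tsupport (kappa a ε)
  · have hv' : a - Real.log 2 ≤ v := (tsupport_kappa_subset hε hv).1
    have hec : ContDiff ℝ (n : ℕ∞) (fun s => Real.exp (-t * s)) :=
      contDiff_exp.comp (contDiff_const.mul contDiff_id)
    have hexp' : ∀ j ≤ n, ‖iteratedFDeriv ℝ j (fun s => Real.exp (-t * s)) v‖ ≤ (1 + t) ^ n * E := by
      intro j hj
      rw [norm_iteratedFDeriv_eq_norm_iteratedDeriv, iteratedDeriv_exp_const_mul, Real.norm_eq_abs,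
        abs_mul, abs_pow, abs_neg, abs_of_nonneg ht, abs_of_pos (Real.exp_pos _)]
      refine mul_le_mul ?_ (exp_neg_mul_le ht hv') (Real.exp_pos _).le (by positivity)
      calc t ^ j ≤ (1 + t) ^ j := pow_le_pow_left₀ ht (by linarith) j
        _ ≤ (1 + t) ^ n := pow_le_pow_right₀ (by linarith) hj
    have hκi : ∀ i ≤ n, ‖iteratedFDeriv ℝ i (kappa a ε) v‖ ≤ kappaC i * (ε ^ n)⁻¹ := by
      intro i hi
      rw [norm_iteratedFDeriv_eq_norm_iteratedDeriv]
      refine (norm_iteratedDeriv_kappa_le i a hε hε1 v).trans ?_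
      refine mul_le_mul_of_nonneg_left ?_ (kappaC_nonneg i)
      exact inv_anti₀ (pow_pos hε _) (pow_le_pow_of_le_one hε.le hε1 hi)
    rw [← norm_iteratedFDeriv_eq_norm_iteratedDeriv]
    calc ‖iteratedFDeriv ℝ n (kappaT a ε t) v‖
        ≤ ∑ i ∈ Finset.range (n + 1), (n.choose i : ℝ) * ‖iteratedFDeriv ℝ i (kappa a ε) v‖ *
            ‖iteratedFDeriv ℝ (n - i) (fun s => Real.exp (-t * s)) v‖ :=
          norm_iteratedFDeriv_mul_le (contDiff_kappa a ε) hec v (by exact_mod_cast le_rfl)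
      _ ≤ ∑ i ∈ Finset.range (n + 1), (n.choose i : ℝ) * (kappaC i * (ε ^ n)⁻¹) * ((1 + t) ^ n * E) := by
          refine Finset.sum_le_sum fun i hi => ?_
          have hin : i ≤ n := Nat.lt_succ_iff.1 (Finset.mem_range.1 hi)
          have h1 := hκi i hin
          have h2 := hexp' (n - i) (Nat.sub_le n i)
          have h0 : 0 ≤ (n.choose i : ℝ) := by positivity
          calc (n.choose i : ℝ) * ‖iteratedFDeriv ℝ i (kappa a ε) v‖ *
                ‖iteratedFDeriv ℝ (n - i) (fun s => Real.exp (-t * s)) v‖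
              ≤ (n.choose i : ℝ) * (kappaC i * (ε ^ n)⁻¹) *
                ‖iteratedFDeriv ℝ (n - i) (fun s => Real.exp (-t * s)) v‖ := by gcongr
            _ ≤ (n.choose i : ℝ) * (kappaC i * (ε ^ n)⁻¹) * ((1 + t) ^ n * E) := by
                have : 0 ≤ (n.choose i : ℝ) * (kappaC i * (ε ^ n)⁻¹) := by
                  have := kappaC_nonneg i; positivity
                exact mul_le_mul_of_nonneg_left h2 this
      _ = kappaTC n * (ε ^ n)⁻¹ * (1 + t) ^ n * E := by
          rw [kappaTC, Finset.sum_mul, Finset.sum_mul, Finset.sum_mul]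
          refine Finset.sum_congr rfl fun i _ => ?_
          ring
  · have hv2 : v ∉ tsupport (kappaT a ε t) := fun h => hv (by
      refine (tsupport_mul_subset_left (f := kappa a ε) (g := fun s => Real.exp (-t * s))) ?_
      exact h)
    rw [iteratedDeriv_eq_zero_of_notMem_tsupport hv2, norm_zero]
    exact hRHS

/-! ## The weight in the linear variable: `g(r) = κ_t(log r)` -/

/-- **The cube weight** `g_{a,ε,t}(r) = κ_t(log r)` for `r > 0` (and `0` for `r ≤ 0`): smooth,
supported in `[e^a/2, 1]`, equal to `r^{-t}` on `[e^a, e^{-ε}]`. [folklore] -/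
def gfun (a ε t r : ℝ) : ℝ := if 0 < r then kappaT a ε t (Real.log r) else 0

/-- `g(r) = κ_t(log r)` for `r > 0`. [folklore] -/
theorem gfun_of_pos {a ε t r : ℝ} (hr : 0 < r) : gfun a ε t r = kappaT a ε t (Real.log r) := by
  rw [gfun, if_pos hr]

/-- `g = 0` on `(-∞, e^a/2]`. [folklore] -/
theorem gfun_eq_zero_of_le {a ε t r : ℝ} (hr : r ≤ Real.exp a / 2) : gfun a ε t r = 0 := by
  by_cases h0 : 0 < r
  · rw [gfun_of_pos h0]
    apply kappaT_eq_zero_of_le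
    rw [le_sub_iff_add_le, ← Real.log_mul h0.ne' two_ne_zero]
    calc Real.log (r * 2) ≤ Real.log (Real.exp a) := Real.log_le_log (by positivity) (by linarith)
      _ = a := Real.log_exp a
  · rw [gfun, if_neg h0]

/-- `g = 0` on `[1, ∞)`. [folklore] -/
theorem gfun_eq_zero_of_one_le {a ε t r : ℝ} (hε : 0 < ε) (hr : 1 ≤ r) : gfun a ε t r = 0 := by
  rw [gfun_of_pos (by linarith)]
  exact kappaT_eq_zero_of_ge hε (Real.log_nonneg hr)

/-- `supp g ⊆ [e^a/2, 1]`. [folklore] -/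
theorem support_gfun_subset {a ε : ℝ} (hε : 0 < ε) (t : ℝ) :
    Function.support (gfun a ε t) ⊆ Icc (Real.exp a / 2) 1 := by
  intro r hr
  rw [Function.mem_support] at hr
  rw [mem_Icc]
  constructor
  · by_contra h; push Not at h; exact hr (gfun_eq_zero_of_le h.le)
  · by_contra h; push Not at h; exact hr (gfun_eq_zero_of_one_le hε h.le)

/-- `tsupp g ⊆ [e^a/2, 1]`. [folklore] -/
theorem tsupport_gfun_subset {a ε : ℝ} (hε : 0 < ε) (t : ℝ) :
    tsupport (gfun a ε t) ⊆ Icc (Real.exp a / 2) 1 :=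
  closure_minimal (support_gfun_subset hε t) isClosed_Icc

/-- `g` has compact support. [folklore] -/
theorem hasCompactSupport_gfun {a ε : ℝ} (hε : 0 < ε) (t : ℝ) : HasCompactSupport (gfun a ε t) :=
  HasCompactSupport.of_support_subset_isCompact isCompact_Icc (support_gfun_subset hε t)

/-- Near a positive point `g` is `κ_t ∘ log`. [folklore] -/
theorem gfun_eventuallyEq_comp {a ε t r : ℝ} (hr : 0 < r) :
    gfun a ε t =ᶠ[𝓝 r] fun s => kappaT a ε t (Real.log s) :=
  (eventually_gt_nhds hr).mono fun _ hs => gfun_of_pos hs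

/-- Near a point `< e^a/2` the weight vanishes identically. [folklore] -/
theorem gfun_eventuallyEq_zero {a ε t r : ℝ} (hr : r < Real.exp a / 2) :
    gfun a ε t =ᶠ[𝓝 r] fun _ => 0 :=
  (eventually_lt_nhds hr).mono fun _ hs => gfun_eq_zero_of_le hs.le

/-- `g` is smooth. [folklore] -/
theorem contDiff_gfun (a ε t : ℝ) {n : ℕ∞} : ContDiff ℝ n (gfun a ε t) := by
  rw [contDiff_iff_contDiffAt]
  intro r
  by_cases hr : 0 < r
  · exact ((contDiff_kappaT a ε t).contDiffAt.comp r (Real.contDiffAt_log.2 hr.ne')).congr_of_eventuallyEq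
      (gfun_eventuallyEq_comp hr)
  · have hr' : r < Real.exp a / 2 := lt_of_le_of_lt (not_lt.1 hr) (by positivity)
    exact (contDiffAt_const (c := (0 : ℝ))).congr_of_eventuallyEq (gfun_eventuallyEq_zero hr')

/-- `|g(r)| ≤ e^{t(log 2 - a)}` (`t ≥ 0`). [folklore] -/
theorem abs_gfun_le {a ε t : ℝ} (ht : 0 ≤ t) (r : ℝ) : |gfun a ε t r| ≤ Real.exp (t * (Real.log 2 - a)) := by
  by_cases hr : 0 < r
  · rw [gfun_of_pos hr]; exact abs_kappaT_le ht _
  · rw [gfun, if_neg hr, abs_zero]; positivity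

/-! ### The third derivative -/

/-- Derivatives agree on `(0, ∞)` if the functions do. [folklore] -/
theorem eqOn_deriv_Ioi {f g : ℝ → ℝ} (h : EqOn f g (Ioi 0)) : EqOn (deriv f) (deriv g) (Ioi 0) :=
  fun _ hr => (h.eventuallyEq_of_mem (Ioi_mem_nhds hr)).deriv_eq

/-- The chain rule for `F ∘ log` on `(0, ∞)`. [folklore] -/
theorem hasDerivAt_comp_log {F : ℝ → ℝ} (hF : Differentiable ℝ F) {r : ℝ} (hr : 0 < r) :
    HasDerivAt (fun s => F (Real.log s)) (deriv F (Real.log r) * r⁻¹) r :=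
  (hF _).hasDerivAt.comp r (Real.hasDerivAt_log hr.ne')

/-- **The third derivative of `g`**: for `r > 0`,
`g⁽³⁾(r) = (κ_t⁽³⁾(log r) - 3 κ_t⁽²⁾(log r) + 2 κ_t⁽¹⁾(log r)) / r³`. [folklore] -/
theorem iteratedDeriv_three_gfun {a ε t r : ℝ} (hr : 0 < r) :
    iteratedDeriv 3 (gfun a ε t) r =
      (iteratedDeriv 3 (kappaT a ε t) (Real.log r) - 3 * iteratedDeriv 2 (kappaT a ε t) (Real.log r) +
        2 * iteratedDeriv 1 (kappaT a ε t) (Real.log r)) * (r ^ 3)⁻¹ := by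
  set k := kappaT a ε t with hk
  have hkd : ∀ n : ℕ, Differentiable ℝ (iteratedDeriv n k) := fun n =>
    ((contDiff_kappaT a ε t (n := ⊤)).differentiable_iteratedDeriv n (by exact_mod_cast WithTop.coe_lt_top _))
  -- the three explicit derivatives on `(0, ∞)`
  set G₁ : ℝ → ℝ := fun s => iteratedDeriv 1 k (Real.log s) * s⁻¹ with hG₁
  set G₂ : ℝ → ℝ := fun s => (iteratedDeriv 2 k (Real.log s) - iteratedDeriv 1 k (Real.log s)) * (s ^ 2)⁻¹
    with hG₂
  set G₃ : ℝ → ℝ := fun s => (iteratedDeriv 3 k (Real.log s) - 3 * iteratedDeriv 2 k (Real.log s) +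
    2 * iteratedDeriv 1 k (Real.log s)) * (s ^ 3)⁻¹ with hG₃
  have h1 : EqOn (deriv (gfun a ε t)) G₁ (Ioi 0) := by
    intro s hs
    rw [(gfun_eventuallyEq_comp (a := a) (ε := ε) (t := t) hs).deriv_eq]
    have h := hasDerivAt_comp_log (hkd 0) hs
    simp only [iteratedDeriv_zero] at h
    rw [hG₁, h.deriv, ← iteratedDeriv_one]
  have h2 : EqOn (deriv G₁) G₂ (Ioi 0) := by
    intro s hs
    have hs0 : s ≠ 0 := ne_of_gt hs
    have hA := hasDerivAt_comp_log (hkd 1) hs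
    rw [← iteratedDeriv_succ] at hA
    have hB : HasDerivAt (fun x : ℝ => x⁻¹) (-(s ^ 2)⁻¹) s := hasDerivAt_inv hs0
    have h : HasDerivAt (fun x => iteratedDeriv 1 k (Real.log x) * x⁻¹)
        (iteratedDeriv (1 + 1) k (Real.log s) * s⁻¹ * s⁻¹ + iteratedDeriv 1 k (Real.log s) * -(s ^ 2)⁻¹) s :=
      hA.mul hB
    rw [hG₂, hG₁, h.deriv]
    field_simp
    ring
  have h3 : EqOn (deriv G₂) G₃ (Ioi 0) := by
    intro s hs
    have hs0 : s ≠ 0 := ne_of_gt hs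
    have hA2 := hasDerivAt_comp_log (hkd 2) hs
    have hA1 := hasDerivAt_comp_log (hkd 1) hs
    rw [← iteratedDeriv_succ] at hA2 hA1
    have hB : HasDerivAt (fun x : ℝ => (x ^ 2)⁻¹) (-(↑(2 : ℕ) * s ^ (2 - 1)) / (s ^ 2) ^ 2) s :=
      (hasDerivAt_pow 2 s).inv (pow_ne_zero _ hs0)
    have h : HasDerivAt (fun x => (iteratedDeriv 2 k (Real.log x) - iteratedDeriv 1 k (Real.log x)) * (x ^ 2)⁻¹)
        ((iteratedDeriv (2 + 1) k (Real.log s) * s⁻¹ - iteratedDeriv (1 + 1) k (Real.log s) * s⁻¹) * (s ^ 2)⁻¹ +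
          (iteratedDeriv 2 k (Real.log s) - iteratedDeriv 1 k (Real.log s)) *
            (-(↑(2 : ℕ) * s ^ (2 - 1)) / (s ^ 2) ^ 2)) s :=
      (hA2.sub hA1).mul hB
    rw [hG₃, hG₂, h.deriv]
    push_cast
    field_simp
    ring
  -- assemble: the third derivative is `deriv (deriv (deriv g))`
  have e1 : EqOn (deriv (deriv (gfun a ε t))) G₂ (Ioi 0) := fun s hs => by
    rw [eqOn_deriv_Ioi h1 hs]; exact h2 hs
  have e2 : EqOn (deriv (deriv (deriv (gfun a ε t)))) G₃ (Ioi 0) := fun s hs => by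
    rw [eqOn_deriv_Ioi e1 hs]; exact h3 hs
  rw [show (3 : ℕ) = 2 + 1 from rfl, iteratedDeriv_succ, iteratedDeriv_succ, iteratedDeriv_one]
  exact e2 hr

/-- All derivatives of `g` vanish below `e^a/2`. [folklore] -/
theorem iteratedDeriv_gfun_eq_zero {a ε t r : ℝ} (hr : r < Real.exp a / 2) (n : ℕ) :
    iteratedDeriv n (gfun a ε t) r = 0 := by
  have h := (gfun_eventuallyEq_zero (a := a) (ε := ε) (t := t) hr).iteratedDeriv n
  rw [h.eq_of_nhds, iteratedDeriv_const]
  split_ifs <;> rfl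

/-- The constant `K₃ = K'₁ + K'₂ + K'₃` dominating the first three derivative constants. [folklore] -/
def K3 : ℝ := kappaTC 1 + kappaTC 2 + kappaTC 3

/-- `K₃ ≥ 0`. [folklore] -/
theorem K3_nonneg : 0 ≤ K3 := by
  unfold K3
  have h1 := kappaTC_nonneg 1
  have h2 := kappaTC_nonneg 2
  have h3 := kappaTC_nonneg 3
  positivity

/-- `kappaTC n ≤ K₃` for `n = 1, 2, 3`. [folklore] -/
theorem kappaTC_le_K3 {n : ℕ} (hn1 : 1 ≤ n) (hn3 : n ≤ 3) : kappaTC n ≤ K3 := by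
  unfold K3
  have h1 := kappaTC_nonneg 1
  have h2 := kappaTC_nonneg 2
  have h3 := kappaTC_nonneg 3
  interval_cases n <;> linarith

/-- **Bound for the third derivative of `g`**:
`|g⁽³⁾(r)| ≤ 48 K₃ ε^{-3} (1+t)³ e^{t(log 2 - a)} e^{-3a}` for all `r`. [folklore] -/
theorem norm_iteratedDeriv_three_gfun_le {a ε t : ℝ} (hε : 0 < ε) (hε1 : ε ≤ 1) (ht : 0 ≤ t) (r : ℝ) :
    ‖iteratedDeriv 3 (gfun a ε t) r‖ ≤
      48 * K3 * (ε ^ 3)⁻¹ * (1 + t) ^ 3 * Real.exp (t * (Real.log 2 - a)) * Real.exp (-3 * a) := by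
  set E := Real.exp (t * (Real.log 2 - a)) with hE
  have hK := K3_nonneg
  by_cases hr : r < Real.exp a / 2
  · rw [iteratedDeriv_gfun_eq_zero hr, norm_zero]; positivity
  push Not at hr
  have hea : 0 < Real.exp a / 2 := by positivity
  have hr0 : 0 < r := lt_of_lt_of_le hea hr
  rw [iteratedDeriv_three_gfun hr0, norm_mul]
  have hn3 : ‖(r ^ 3)⁻¹‖ = (r ^ 3)⁻¹ := by
    rw [Real.norm_eq_abs, abs_of_pos (by positivity)]
  rw [hn3]
  -- each `κ_t^{(n)}`, `n = 1,2,3`, is bounded by `K₃ ε^{-3} (1+t)^3 E`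
  have hB : ∀ n, 1 ≤ n → n ≤ 3 →
      ‖iteratedDeriv n (kappaT a ε t) (Real.log r)‖ ≤ K3 * (ε ^ 3)⁻¹ * (1 + t) ^ 3 * E := by
    intro n hn1 hn3
    refine (norm_iteratedDeriv_kappaT_le n a hε hε1 ht _).trans ?_
    have ht1 : 1 ≤ 1 + t := by linarith
    have hK' := kappaTC_nonneg n
    have hε3 : (ε ^ n)⁻¹ ≤ (ε ^ 3)⁻¹ := inv_anti₀ (pow_pos hε _) (pow_le_pow_of_le_one hε.le hε1 hn3)
    have ht3 : (1 + t) ^ n ≤ (1 + t) ^ 3 := pow_le_pow_right₀ ht1 hn3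
    have hE0 : 0 < E := Real.exp_pos _
    refine mul_le_mul_of_nonneg_right ?_ hE0.le
    exact mul_le_mul (mul_le_mul (kappaTC_le_K3 hn1 hn3) hε3 (by positivity) hK) ht3 (by positivity)
      (by positivity)
  have hsum : ‖iteratedDeriv 3 (kappaT a ε t) (Real.log r) - 3 * iteratedDeriv 2 (kappaT a ε t) (Real.log r) +
      2 * iteratedDeriv 1 (kappaT a ε t) (Real.log r)‖ ≤ 6 * (K3 * (ε ^ 3)⁻¹ * (1 + t) ^ 3 * E) := by
    have h3 := hB 3 (by norm_num) le_rfl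
    have h2 := hB 2 (by norm_num) (by norm_num)
    have h1 := hB 1 le_rfl (by norm_num)
    have hn2 : ‖3 * iteratedDeriv 2 (kappaT a ε t) (Real.log r)‖ ≤ 3 * (K3 * (ε ^ 3)⁻¹ * (1 + t) ^ 3 * E) := by
      rw [norm_mul, Real.norm_ofNat]; linarith
    have hn1 : ‖2 * iteratedDeriv 1 (kappaT a ε t) (Real.log r)‖ ≤ 2 * (K3 * (ε ^ 3)⁻¹ * (1 + t) ^ 3 * E) := by
      rw [norm_mul, Real.norm_ofNat]; linarith
    calc _ ≤ ‖iteratedDeriv 3 (kappaT a ε t) (Real.log r) - 3 * iteratedDeriv 2 (kappaT a ε t) (Real.log r)‖ +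
          ‖2 * iteratedDeriv 1 (kappaT a ε t) (Real.log r)‖ := norm_add_le _ _
      _ ≤ ‖iteratedDeriv 3 (kappaT a ε t) (Real.log r)‖ + ‖3 * iteratedDeriv 2 (kappaT a ε t) (Real.log r)‖ +
          ‖2 * iteratedDeriv 1 (kappaT a ε t) (Real.log r)‖ := by
          gcongr; exact norm_sub_le _ _
      _ ≤ _ := by linarith
  -- `r^{-3} ≤ 8 e^{-3a}`
  have hr3 : (r ^ 3)⁻¹ ≤ 8 * Real.exp (-3 * a) := by
    have h1 : (r ^ 3)⁻¹ ≤ ((Real.exp a / 2) ^ 3)⁻¹ :=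
      inv_anti₀ (pow_pos hea 3) (pow_le_pow_left₀ hea.le hr 3)
    refine h1.trans (le_of_eq ?_)
    have : Real.exp (-3 * a) = (Real.exp a)⁻¹ ^ 3 := by
      rw [← Real.exp_neg, ← Real.exp_nat_mul]; push_cast; ring_nf
    rw [this]
    field_simp
    ring
  calc ‖iteratedDeriv 3 (kappaT a ε t) (Real.log r) - 3 * iteratedDeriv 2 (kappaT a ε t) (Real.log r) +
        2 * iteratedDeriv 1 (kappaT a ε t) (Real.log r)‖ * (r ^ 3)⁻¹
      ≤ 6 * (K3 * (ε ^ 3)⁻¹ * (1 + t) ^ 3 * E) * (8 * Real.exp (-3 * a)) :=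
        mul_le_mul hsum hr3 (by positivity) (by positivity)
    _ = _ := by ring

/-! ## Integral bounds and the complex-valued weight -/

/-- A function bounded by `B` and supported in `[lo, hi]` has `∫ |f| ≤ B (hi - lo)`. [folklore] -/
theorem integral_norm_le_of_support {f : ℝ → ℂ} {B lo hi : ℝ} (hlohi : lo ≤ hi)
    (hf : ∀ r, ‖f r‖ ≤ B) (hsupp : Function.support f ⊆ Icc lo hi) :
    ∫ r, ‖f r‖ ≤ B * (hi - lo) := by
  have h1 : ∫ r, ‖f r‖ = ∫ r in Icc lo hi, ‖f r‖ := by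
    refine (setIntegral_eq_integral_of_forall_compl_eq_zero fun r hr => ?_).symm
    rw [norm_eq_zero]
    by_contra h
    exact hr (hsupp (Function.mem_support.2 h))
  rw [h1]
  calc ∫ r in Icc lo hi, ‖f r‖ ≤ ‖∫ r in Icc lo hi, ‖f r‖‖ := Real.le_norm_self _
    _ ≤ B * (volume : Measure ℝ).real (Icc lo hi) :=
        norm_setIntegral_le_of_norm_le_const measure_Icc_lt_top fun r _ => by
          rw [norm_norm]; exact hf r
    _ = B * (hi - lo) := by rw [Real.volume_real_Icc_of_le hlohi]

/-- The cube weight as a complex-valued function (for Fourier analysis). [folklore] -/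
def gfunC (a ε t r : ℝ) : ℂ := (gfun a ε t r : ℂ)

/-- `gfunC = ofReal ∘ gfun`. [folklore] -/
theorem gfunC_eq_comp (a ε t : ℝ) : gfunC a ε t = Complex.ofRealCLM ∘ gfun a ε t := rfl

/-- `g` is smooth as a complex-valued function. [folklore] -/
theorem contDiff_gfunC (a ε t : ℝ) {n : ℕ∞} : ContDiff ℝ n (gfunC a ε t) := by
  rw [gfunC_eq_comp]; exact Complex.ofRealCLM.contDiff.comp (contDiff_gfun a ε t)

/-- `g` is continuous (complex-valued). [folklore] -/
theorem continuous_gfunC (a ε t : ℝ) : Continuous (gfunC a ε t) :=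
  (contDiff_gfunC a ε t (n := 0)).continuous

/-- `supp g ⊆ [e^a/2, 1]` (complex-valued). [folklore] -/
theorem support_gfunC_subset {a ε : ℝ} (hε : 0 < ε) (t : ℝ) :
    Function.support (gfunC a ε t) ⊆ Icc (Real.exp a / 2) 1 := by
  intro r hr
  rw [Function.mem_support, gfunC, Ne, Complex.ofReal_eq_zero] at hr
  exact support_gfun_subset hε t (Function.mem_support.2 hr)

/-- `g` has compact support (complex-valued). [folklore] -/
theorem hasCompactSupport_gfunC {a ε : ℝ} (hε : 0 < ε) (t : ℝ) : HasCompactSupport (gfunC a ε t) :=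
  HasCompactSupport.of_support_subset_isCompact isCompact_Icc (support_gfunC_subset hε t)

/-- Iterated derivatives commute with the coercion `ℝ → ℂ`. [folklore] -/
theorem iteratedDeriv_gfunC (a ε t : ℝ) (n : ℕ) (r : ℝ) :
    iteratedDeriv n (gfunC a ε t) r = ((iteratedDeriv n (gfun a ε t) r : ℝ) : ℂ) := by
  rw [iteratedDeriv_eq_iteratedFDeriv, gfunC_eq_comp,
    ContinuousLinearMap.iteratedFDeriv_comp_left Complex.ofRealCLM
      ((contDiff_gfun a ε t (n := ⊤)).contDiffAt (x := r)) (i := n) (by exact_mod_cast le_top),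
    ContinuousLinearMap.compContinuousMultilinearMap_coe, Function.comp_apply,
    ← iteratedDeriv_eq_iteratedFDeriv]
  rfl

/-- **`L¹` bound for the weight**: `∫ |g| ≤ e^{t(log 2 - a)}` (`a ≤ 0`, `t ≥ 0`). [folklore] -/
theorem integral_norm_gfunC_le {a ε t : ℝ} (ha : a ≤ 0) (hε : 0 < ε) (ht : 0 ≤ t) :
    ∫ r, ‖gfunC a ε t r‖ ≤ Real.exp (t * (Real.log 2 - a)) := by
  have hlohi : Real.exp a / 2 ≤ 1 := by
    have : Real.exp a ≤ 1 := Real.exp_le_one_iff.2 ha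
    linarith
  calc ∫ r, ‖gfunC a ε t r‖ ≤ Real.exp (t * (Real.log 2 - a)) * (1 - Real.exp a / 2) :=
        integral_norm_le_of_support hlohi
          (fun r => by rw [gfunC, Complex.norm_real, Real.norm_eq_abs]; exact abs_gfun_le ht r)
          (support_gfunC_subset hε t)
    _ ≤ Real.exp (t * (Real.log 2 - a)) * 1 := by
        gcongr; linarith [Real.exp_pos a]
    _ = _ := mul_one _

/-- **`L¹` bound for the third derivative**:
`∫ |g⁽³⁾| ≤ 48 K₃ ε^{-3} (1+t)³ e^{t(log 2 - a)} e^{-3a}` (`a ≤ 0`, `0 < ε ≤ 1`, `t ≥ 0`). [folklore] -/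
theorem integral_norm_iteratedDeriv_gfunC_le {a ε t : ℝ} (ha : a ≤ 0) (hε : 0 < ε) (hε1 : ε ≤ 1)
    (ht : 0 ≤ t) :
    ∫ r, ‖iteratedDeriv 3 (gfunC a ε t) r‖ ≤
      48 * K3 * (ε ^ 3)⁻¹ * (1 + t) ^ 3 * Real.exp (t * (Real.log 2 - a)) * Real.exp (-3 * a) := by
  have hlohi : Real.exp a / 2 ≤ 1 := by
    have : Real.exp a ≤ 1 := Real.exp_le_one_iff.2 ha
    linarith
  have hK := K3_nonneg
  have hsupp : Function.support (iteratedDeriv 3 (gfunC a ε t)) ⊆ Icc (Real.exp a / 2) 1 := by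
    intro r hr
    have h1 : r ∈ Function.support (iteratedFDeriv ℝ 3 (gfunC a ε t)) := by
      rw [Function.mem_support] at hr ⊢
      intro h0
      apply hr
      rw [iteratedDeriv_eq_iteratedFDeriv, h0, zero_apply]
    have h2 := support_iteratedFDeriv_subset 3 h1
    exact closure_minimal (support_gfunC_subset hε t) isClosed_Icc h2
  calc ∫ r, ‖iteratedDeriv 3 (gfunC a ε t) r‖
      ≤ 48 * K3 * (ε ^ 3)⁻¹ * (1 + t) ^ 3 * Real.exp (t * (Real.log 2 - a)) * Real.exp (-3 * a) *
          (1 - Real.exp a / 2) :=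
        integral_norm_le_of_support hlohi
          (fun r => by
            rw [iteratedDeriv_gfunC, Complex.norm_real]
            exact norm_iteratedDeriv_three_gfun_le hε hε1 ht r)
          hsupp
    _ ≤ 48 * K3 * (ε ^ 3)⁻¹ * (1 + t) ^ 3 * Real.exp (t * (Real.log 2 - a)) * Real.exp (-3 * a) * 1 := by
        gcongr; linarith [Real.exp_pos a]
    _ = _ := mul_one _

/-- **Summary of the properties of the cube weight used downstream** (`a ≤ 0`, `0 < ε ≤ 1`,
`t ≥ 0`): smoothness, compact support in `[e^a/2, 1]`, the pointwise bound, and the two `L¹`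
bounds. [folklore] -/
theorem gfunC_props {a ε t : ℝ} (ha : a ≤ 0) (hε : 0 < ε) (hε1 : ε ≤ 1) (ht : 0 ≤ t) :
    ContDiff ℝ 3 (gfunC a ε t) ∧ HasCompactSupport (gfunC a ε t) ∧
      Function.support (gfunC a ε t) ⊆ Icc (Real.exp a / 2) 1 ∧
      (∀ r, ‖gfunC a ε t r‖ ≤ Real.exp (t * (Real.log 2 - a))) ∧
      (∫ r, ‖gfunC a ε t r‖ ≤ Real.exp (t * (Real.log 2 - a))) ∧
      (∫ r, ‖iteratedDeriv 3 (gfunC a ε t) r‖ ≤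
        48 * K3 * (ε ^ 3)⁻¹ * (1 + t) ^ 3 * Real.exp (t * (Real.log 2 - a)) * Real.exp (-3 * a)) :=
  ⟨contDiff_gfunC a ε t, hasCompactSupport_gfunC hε t, support_gfunC_subset hε t,
    fun r => by rw [gfunC, Complex.norm_real, Real.norm_eq_abs]; exact abs_gfun_le ht r,
    integral_norm_gfunC_le ha hε ht, integral_norm_iteratedDeriv_gfunC_le ha hε hε1 ht⟩

/-- **The plateau**: `g(r) = r^{-t}` for `e^a ≤ r ≤ e^{-ε}`. [folklore] -/
theorem gfun_eq_rpow {a ε t r : ℝ} (hε : 0 < ε) (har : Real.exp a ≤ r) (hrε : r ≤ Real.exp (-ε)) :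
    gfun a ε t r = r ^ (-t) := by
  have hr : 0 < r := lt_of_lt_of_le (Real.exp_pos a) har
  rw [gfun_of_pos hr, kappaT, kappa_eq_one hε, one_mul, Real.rpow_def_of_pos hr]
  · congr 1; ring
  · rw [← Real.log_exp a]; exact Real.log_le_log (Real.exp_pos a) har
  · rw [← Real.log_exp (-ε)]; exact Real.log_le_log hr hrε

/-- **The layers**: `0 ≤ g ≤ r^{-t}` everywhere on `(0, ∞)`; in particular for `t = 0` the weight
`g` lies between the indicators of `[e^a, e^{-ε}]` and of `(e^a/2, 1)`. [folklore] -/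
theorem gfun_nonneg (a ε t r : ℝ) : 0 ≤ gfun a ε t r := by
  by_cases hr : 0 < r
  · rw [gfun_of_pos hr, kappaT]; exact mul_nonneg (kappa_nonneg _ _ _) (Real.exp_pos _).le
  · rw [gfun, if_neg hr]

/-- `g(r) ≤ r^{-t}` for `r > 0`. [folklore] -/
theorem gfun_le_rpow {a ε t r : ℝ} (hr : 0 < r) : gfun a ε t r ≤ r ^ (-t) := by
  rw [gfun_of_pos hr, kappaT, Real.rpow_def_of_pos hr]
  calc kappa a ε (Real.log r) * Real.exp (-t * Real.log r) ≤ 1 * Real.exp (-t * Real.log r) :=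
        mul_le_mul_of_nonneg_right (kappa_le_one _ _ _) (Real.exp_pos _).le
    _ = Real.exp (Real.log r * -t) := by rw [one_mul]; congr 1; ring

end Literature.NumberTheory.Sieve.SmoothWeights
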